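import Mathlib
import HarnessLib

/-!
# The small-time floor of one block term of the explicit entropy floor: `n·A·c⁴/128 ≤ log(1 + (max 0 ((c⁴/8)·n·A − 4(I·ρc³)²))/(2 + 2I·μc²))` for `4I²ρ²c² ≤ nA/16`, `Iμc² ≤ 1`, `nAc⁴ ≤ 64`

HONEST FRAMING: exact (Metropolis-corrected) sampling algorithms for lattice gauge theory;
figures of merit are autocorrelation/cost numbers at stated couplings and volumes; no
continuum-physics claim.

Venture `LatticeQCDFlow` (cell pub-lqcd), topic `Exactness`; FANOUT row 7 (`s0-cpn-null`).  NEW WORK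
of the cell over Mathlib only (`Real.one_sub_inv_le_log_of_pos` — `x/2 ≤ log(1+x)` on `[0,1]` —, `Finset.card_nsmul_le_sum`);
nothing is cited as a fact.  The point: each block term of this lineage's explicit extensive floor for
the reverse relative entropy of the exact leading-order flow sampler
(`Exactness/SphereLOFlowEntropyFloorExplicit`: blocks `B_j` carrying `n_j` disjoint coupled pairs,
`I_j` sites in their cone neighbourhood) has the shape
`Θ(n, I; c) = log(1 + (max 0 ((c⁴/8)·(n·A) − 4·(I·(ρ·c³))²))/(2 + 2·(I·(μ·c²))))` with the model
constants `A = 32κ⁴β₀⁴/((d−1)d²(d+2))`, `ρ = 4|κ|³υ³/(d−1)²`, `μ = κ²υ²/(d−1)`; here the elementary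
facts that turn that floor into (number of blocks)·(n₀A/128)·c⁴ − tail for SMALL flow times: `Θ` is
monotone (up in `n`, down in `I`) and `Θ(n, I; c) ≥ n·A·c⁴/128` as soon as `4I²ρ²c² ≤ nA/16`,
`Iμc² ≤ 1` and `nAc⁴ ≤ 64` — three explicit smallness conditions on `c`, uniform in the volume when
`n` and `I` are.

## Content

* **`blockTerm_mono`** — monotonicity of `Θ` in `(n, I)`;
* **`blockTerm_ge_of_small_time`** — THE SMALL-TIME FLOOR `n·A·c⁴/128 ≤ Θ(n, I; c)`;
* **`card_mul_le_sum_blockTerm_of_small_time`** — over a finite family of blocks with `n₀ ≤ n_j`,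
  `0 ≤ I_j ≤ I₀` and `c` small for `(n₀, I₀)`: `|T|·n₀·A·c⁴/128 ≤ Σ_j Θ(n_j, I_j; c)`.

NOT CLAIMED: anything about measures, flows or numbers; optimal constants.
-/

noncomputable section

namespace Summit.Ventures.LatticeQCDFlow.Exactness

/-- **Monotonicity of the block term** `Θ(n, I; c) = log(1 + (max 0 ((c⁴/8)(nA) − 4(I(ρc³))²))/(2 + 2(I(μc²))))`:
increasing in the pair count `n` (`A ≥ 0`) and decreasing in the neighbourhood size `I ≥ 0` (`μ ≥ 0`). -/
theorem blockTerm_mono {A ρ μ c n n₀ I I₀ : ℝ} (hA : 0 ≤ A) (hμ : 0 ≤ μ) (hn : n₀ ≤ n) (hI0 : 0 ≤ I)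
    (hI : I ≤ I₀) :
    Real.log (1 + (max 0 (c ^ 4 / 8 * (n₀ * A) - 4 * (I₀ * (ρ * c ^ 3)) ^ 2)) / (2 + 2 * (I₀ * (μ * c ^ 2)))) ≤
      Real.log (1 + (max 0 (c ^ 4 / 8 * (n * A) - 4 * (I * (ρ * c ^ 3)) ^ 2)) / (2 + 2 * (I * (μ * c ^ 2)))) := by
  have hc4 : 0 ≤ c ^ 4 := by positivity
  have hμc : 0 ≤ μ * c ^ 2 := by positivity
  have hI0' : 0 ≤ I₀ := hI0.trans hI
  have hD : 0 < 2 + 2 * (I * (μ * c ^ 2)) := by positivity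
  have hD' : 0 < 2 + 2 * (I₀ * (μ * c ^ 2)) := by positivity
  have hsq : (I * (ρ * c ^ 3)) ^ 2 ≤ (I₀ * (ρ * c ^ 3)) ^ 2 := by
    rw [mul_pow, mul_pow I₀]
    exact mul_le_mul_of_nonneg_right (pow_le_pow_left₀ hI0 hI 2) (sq_nonneg _)
  have hnum : max 0 (c ^ 4 / 8 * (n₀ * A) - 4 * (I₀ * (ρ * c ^ 3)) ^ 2) ≤
      max 0 (c ^ 4 / 8 * (n * A) - 4 * (I * (ρ * c ^ 3)) ^ 2) :=
    max_le_max le_rfl (by nlinarith [mul_le_mul_of_nonneg_right hn hA])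
  have hden : 2 + 2 * (I * (μ * c ^ 2)) ≤ 2 + 2 * (I₀ * (μ * c ^ 2)) := by
    nlinarith [mul_le_mul_of_nonneg_right hI hμc]
  have hfrac : max 0 (c ^ 4 / 8 * (n₀ * A) - 4 * (I₀ * (ρ * c ^ 3)) ^ 2) / (2 + 2 * (I₀ * (μ * c ^ 2))) ≤
      max 0 (c ^ 4 / 8 * (n * A) - 4 * (I * (ρ * c ^ 3)) ^ 2) / (2 + 2 * (I * (μ * c ^ 2))) :=
    div_le_div₀ (le_max_left _ _) hnum hD hden
  have hpos : 0 < 1 + max 0 (c ^ 4 / 8 * (n₀ * A) - 4 * (I₀ * (ρ * c ^ 3)) ^ 2) /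
      (2 + 2 * (I₀ * (μ * c ^ 2))) := by
    have : 0 ≤ max 0 (c ^ 4 / 8 * (n₀ * A) - 4 * (I₀ * (ρ * c ^ 3)) ^ 2) /
        (2 + 2 * (I₀ * (μ * c ^ 2))) := div_nonneg (le_max_left _ _) hD'.le
    linarith
  exact Real.log_le_log hpos (by linarith)

/-- **THE SMALL-TIME FLOOR OF ONE BLOCK TERM**: for `0 ≤ n`, `0 ≤ A`, `0 ≤ I`, `0 ≤ μ` and a flow time
with `4I²ρ²c² ≤ nA/16`, `Iμc² ≤ 1`, `nAc⁴ ≤ 64`: `n·A·c⁴/128 ≤ Θ(n, I; c)` (the numerator is at least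
`nAc⁴/16`, the denominator at most `4`, and `log(1 + x) ≥ x/2` on `[0, 1]`). -/
theorem blockTerm_ge_of_small_time {A ρ μ c n I : ℝ} (hn : 0 ≤ n) (hA : 0 ≤ A) (hI : 0 ≤ I) (hμ : 0 ≤ μ)
    (h1 : 4 * I ^ 2 * ρ ^ 2 * c ^ 2 ≤ n * A / 16) (h2 : I * μ * c ^ 2 ≤ 1) (h3 : n * A * c ^ 4 ≤ 64) :
    n * A * c ^ 4 / 128 ≤
      Real.log (1 + (max 0 (c ^ 4 / 8 * (n * A) - 4 * (I * (ρ * c ^ 3)) ^ 2)) / (2 + 2 * (I * (μ * c ^ 2)))) := by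
  have hc4 : 0 ≤ c ^ 4 := by positivity
  have hD : 0 < 2 + 2 * (I * (μ * c ^ 2)) := by positivity
  have hnum : n * A * c ^ 4 / 16 ≤ max 0 (c ^ 4 / 8 * (n * A) - 4 * (I * (ρ * c ^ 3)) ^ 2) := by
    refine le_trans ?_ (le_max_right _ _)
    have e : 4 * (I * (ρ * c ^ 3)) ^ 2 = (4 * I ^ 2 * ρ ^ 2 * c ^ 2) * c ^ 4 := by ring
    rw [e]
    nlinarith [mul_le_mul_of_nonneg_right h1 hc4]
  have hden : 2 + 2 * (I * (μ * c ^ 2)) ≤ 4 := by nlinarith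
  have hx : n * A * c ^ 4 / 64 ≤
      max 0 (c ^ 4 / 8 * (n * A) - 4 * (I * (ρ * c ^ 3)) ^ 2) / (2 + 2 * (I * (μ * c ^ 2))) :=
    calc n * A * c ^ 4 / 64 = (n * A * c ^ 4 / 16) / 4 := by ring
      _ ≤ (n * A * c ^ 4 / 16) / (2 + 2 * (I * (μ * c ^ 2))) :=
          div_le_div_of_nonneg_left (by positivity) hD hden
      _ ≤ max 0 (c ^ 4 / 8 * (n * A) - 4 * (I * (ρ * c ^ 3)) ^ 2) / (2 + 2 * (I * (μ * c ^ 2))) :=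
          div_le_div_of_nonneg_right hnum hD.le
  have hx0 : 0 ≤ n * A * c ^ 4 / 64 := by positivity
  have hx1 : n * A * c ^ 4 / 64 ≤ 1 := by linarith
  -- `x/2 ≤ x/(1+x) = 1 − (1+x)⁻¹ ≤ log(1+x)` on `[0, 1]`
  have hlog : ∀ x : ℝ, 0 ≤ x → x ≤ 1 → x / 2 ≤ Real.log (1 + x) := by
    intro x h0 h1
    have hpos : 0 < 1 + x := by linarith
    have h := Real.one_sub_inv_le_log_of_pos hpos
    have e : x / (1 + x) = 1 - (1 + x)⁻¹ := by
      field_simp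
      ring
    exact le_trans (div_le_div_of_nonneg_left h0 hpos (by linarith)) (e ▸ h)
  calc n * A * c ^ 4 / 128 = (n * A * c ^ 4 / 64) / 2 := by ring
    _ ≤ Real.log (1 + n * A * c ^ 4 / 64) := hlog _ hx0 hx1
    _ ≤ Real.log (1 + (max 0 (c ^ 4 / 8 * (n * A) - 4 * (I * (ρ * c ^ 3)) ^ 2)) /
          (2 + 2 * (I * (μ * c ^ 2)))) := Real.log_le_log (by linarith) (by linarith)

/-- **Summing over blocks.**  For a finite family of blocks with pair counts `n_j ≥ n₀ ≥ 0` and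
neighbourhood sizes `0 ≤ I_j ≤ I₀` (`j ∈ T`), `A, μ ≥ 0`, and a flow time small for `(n₀, I₀)`
(`4I₀²ρ²c² ≤ n₀A/16`, `I₀μc² ≤ 1`, `n₀Ac⁴ ≤ 64`): `|T|·n₀·A·c⁴/128 ≤ Σ_{j∈T} Θ(n_j, I_j; c)`. -/
theorem card_mul_le_sum_blockTerm_of_small_time {J : Type*} (T : Finset J) {nn II : J → ℝ}
    {A ρ μ c n₀ I₀ : ℝ} (hn0 : 0 ≤ n₀) (hA : 0 ≤ A) (hμ : 0 ≤ μ) (hn : ∀ j ∈ T, n₀ ≤ nn j)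
    (hI0 : ∀ j ∈ T, 0 ≤ II j) (hI : ∀ j ∈ T, II j ≤ I₀)
    (h1 : 4 * I₀ ^ 2 * ρ ^ 2 * c ^ 2 ≤ n₀ * A / 16) (h2 : I₀ * μ * c ^ 2 ≤ 1) (h3 : n₀ * A * c ^ 4 ≤ 64) :
    (T.card : ℝ) * (n₀ * A * c ^ 4 / 128) ≤
      ∑ j ∈ T, Real.log (1 + (max 0 (c ^ 4 / 8 * (nn j * A) - 4 * (II j * (ρ * c ^ 3)) ^ 2)) /
        (2 + 2 * (II j * (μ * c ^ 2)))) := by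
  by_cases hT : T = ∅
  · simp [hT]
  obtain ⟨j₀, hj₀⟩ := Finset.nonempty_iff_ne_empty.2 hT
  have hI00 : 0 ≤ I₀ := (hI0 j₀ hj₀).trans (hI j₀ hj₀)
  have h := Finset.card_nsmul_le_sum T
    (fun j => Real.log (1 + (max 0 (c ^ 4 / 8 * (nn j * A) - 4 * (II j * (ρ * c ^ 3)) ^ 2)) /
      (2 + 2 * (II j * (μ * c ^ 2)))))
    (n₀ * A * c ^ 4 / 128) fun j hj =>
      le_trans (blockTerm_ge_of_small_time hn0 hA hI00 hμ h1 h2 h3)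
        (blockTerm_mono hA hμ (hn j hj) (hI0 j hj) (hI j hj))
  rwa [nsmul_eq_mul] at h

end Summit.Ventures.LatticeQCDFlow.Exactness

end
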